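import Literature.MathematicalPhysics.QuantumFieldTheory.Balaban1983to89.Node00.Record13LettersOfThm1CCMW
import Literature.MathematicalPhysics.QuantumFieldTheory.Balaban1983to89.Node00.Record13ReverseComparabilityOfBetaBox

/-!
# NODE 00 (YM-PLAN Track A) — STAGE 13: THE SIGN-FREE COMPARABILITY OF CONSECUTIVE THRESHOLDS — both history clauses (hcomp) ∧ (hcompRev) of row `bg` along every windowed run
# of a Stage-13 parameter FROM A TWO-SIDED β-BOX `bₗ ≤ β₁₃(θ) ≤ β′` ON `]0, θ.γ]` WITH `bₗ`, `β′` OF ANY SIGN (letters `−bₗ·γ² ≤ 3`, `β′·γ² ≤ ¾`, `θ.γ ≤ ½`), and at the windowed witness `θ₁₅ᶜᶜᴹ(j; γ)`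

CREDIT.  The observation and the proofs of this file are node O's: ideation seat `ym-nodeO-ideate` P3 g48, memo companion `run/shared/lean/pub/ym-nodeO-ideate/memos/lines/BetaBoxSignFree-P3g48.lean`
(sha256 272e4beb1cdd2f4f…, 756 l., farm rc 0, §§0–3 and §4ʷ), EVIDENCE-N78 on the `pub-ymgap` bus 2026-08-27T19:24:46Z «THE SIGN OF β IS NOT READ BY THE K0 NODE»; re-homed in the tree by
seat `pub-ymgap-dag-n21-c` (g12) at plan g77's SIGNFREE-WORD (V17 = the sign-free stub 3ᴬ), proofs verbatim up to the tree's names (`FlowStep.box_mono`, 13d's `mul_log_inv_le_two_mul`,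
12-history's `inv_sq_genSeq_succ` ∕ `hcomp_mul_of_hcomp`, 14d's `hcompRev_mul_of_hcompRev`).  NEW leaf, theorems only; nothing modified.  `--supports stmt-QuantumFields-20541`.
[III] = [Balaban1988Convergent], [I] = [Balaban1987RG1], [II] = [Balaban1989LargeFieldII], [15] = [Balaban1985Variational].

WHY.  node00-def-K0a's 13e ∕ 14d derive the two history clauses of [III] (2.6)–(2.8) from the β-SIGN (`BetaLowerH b … (0 ≤ b)` ⇒ monotone windowed histories ⇒ (hcomp); 14d's (hcompRev) carries
`hb : 0 ≤ b` too), and so did A2 ∕ A2ʷ ∕ V15's stub 3′ ∕ V16's stub 3ˢ.  But B′ §5's socket `Stage13Params.bgAtDatumCoP_of_thm1RegSepCoP7M_of_thm1GaugeR` reads (hcomp) ∧ (hcompRev) ONLY — and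
both follow from ONE RG step (0.20) `g′⁻² = g⁻² − β` with a ONE-SIDED bound of EITHER sign once the window is small against the bound: `β ≤ β′`, `β′·g² ≤ ¾` ⇒ `g′ ≤ 2g`; `bₗ ≤ β`,
`−bₗ·g² ≤ 3` ⇒ `g ≤ 2g′`; and the (2.4) profile `g·A₀·log g⁻²` (`p₀ = 1`) is 2-comparable along 2-comparable couplings in `]0, ½]` WITHOUT monotonicity (case split at the crossing).  So the
K0 provisos read «β UNIFORMLY BOUNDED on some window» ([I] Thm 1 p.259 ∕ §1 p.264 — STATED in print; the content of [I] Thm 2 p.259, proof unpublished), NOT the sign ([II] p.355 ∕ (1.4) —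
UNPRINTED, T09.F), which LEAVES the K0 node.

WHAT THIS FILE PROVES (theorems only; 0 `def`).
§0 `exists_window_letters_signFree` — inside any window `]0, γ₀]` one `γ ≤ ½` on which `β′ ≥ 0` meets both letters.  §1 `mul_log_inv_le_two_mul_of_le_two_mul`, `epsOfRecord_le_two_mul_of_le_two_mul`
(`0 < g_i ≤ 2g_j`, both `≤ ½` ⇒ `ε_i ≤ 2ε_j` at `p₀ = 1`, `A₀ ≥ 0`).  §2 `le_two_mul_of_inv_sq_step_upper ∕ _lower` (one RG step, `t` of any sign), ★ `hcompBoth_genSeq_of_betaBoxSignFree`.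
§3 ★ θ-generic `Stage13Params.hcompBoth_of_betaBoxSignFree (θ) (hA : 0 ≤ ν.A₀) (hp : ν.p₀ = 1) (hγ : θ.γ ≤ ½) (hcR : 0 ≤ cR) (hlow : BetaLowerH bₗ θ.γ β₁₃(θ)) (hup : BetaUpperH β′ θ.γ β₁₃(θ))
(hl : −bₗ·θ.γ² ≤ 3) (hu : β′·θ.γ² ≤ ¾)` ⊢ (hcomp) ∧ (hcompRev).  §4ʷ at `θ₁₅ᶜᶜᴹ(j; γ)` (`γ ≤ ½`): `hcompBoth_theta13OfThm1CCMW_of_betaBoxSignFree` and — through A2ʷ §5's transfer —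
`…_of_betaBoxSignFree_half` from the sign-free box OF A1's WITNESS `β₁₃(θ₁₅ᶜᶜᴹ(j))` on `]0, γ]`.

HONEST FRAMING.  Elementary real arithmetic on (0.20) and (2.4); CONDITIONAL on the displayed two-sided box; no sign of β derived or assumed; nothing of Bałaban asserted; NOT a discharge; K0⁷
NOT closed (V16 of record; this file prepares V17's stub 3ᴬ road); counts unmoved (typed 28∕28 · discharged 5∕27); one finite 𝕋⁴ programme at fixed ε — NOT continuum ∕ OS ∕ mass gap ∕ Clay.
No `sorry`, no `axiom`, no `def`, no `instance`, no `notation`.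
-/

noncomputable section

open scoped Matrix.Norms.L2Operator

namespace Literature.MathematicalPhysics.QuantumFieldTheory.Balaban1983to89.Node00

open T4Continuum B14.Eq218Concrete B15DeterminingSets B12RegularSpaces111 B14RegularSpaces234 FlowStep FlowStepRuns

/-! ## §0. Window arithmetic: inside any window `]0, γ₀]` there is one `γ ≤ ½` on which the constants meet BOTH letters -/

/-- `0 < γ₀`, `0 ≤ β′` ⟹ some `γ ∈ ]0, γ₀]`, `γ ≤ ½`, with `−(−β′)·γ² ≤ 3` and `β′·γ² ≤ ¾` (`γ := min γ₀ (min ½ (1+β′)⁻¹)`) — the window-shrinking arithmetic behind «γ sufficiently small».  (node O P3 g48 §0.) [cite: Balaban1987RG1, Thm 1 p.259, §1 p.264 (bookkeeping)] -/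
theorem exists_window_letters_signFree {γ₀ β' : ℝ} (hγ0 : 0 < γ₀) (hβ' : 0 ≤ β') :
    ∃ γ : ℝ, 0 < γ ∧ γ ≤ γ₀ ∧ γ ≤ 1 / 2 ∧ -(-β') * γ ^ 2 ≤ 3 ∧ β' * γ ^ 2 ≤ 3 / 4 := by
  have h1 : (0 : ℝ) < 1 / (1 + β') := div_pos one_pos (by linarith)
  refine ⟨min γ₀ (min (1 / 2) (1 / (1 + β'))), lt_min hγ0 (lt_min (by norm_num) h1), min_le_left _ _,
    (min_le_right _ _).trans (min_le_left _ _), ?_, ?_⟩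
  all_goals
    set γ := min γ₀ (min (1 / 2) (1 / (1 + β'))) with hγdef
    have hγ0' : 0 < γ := lt_min hγ0 (lt_min (by norm_num) h1)
    have h2 : γ ≤ 1 / 2 := (min_le_right _ _).trans (min_le_left _ _)
    have h3 : γ ≤ 1 / (1 + β') := (min_le_right _ _).trans (min_le_right _ _)
    have hprod : β' * γ ≤ 1 := by
      have h4 : β' * (1 / (1 + β')) ≤ 1 := by
        rw [mul_one_div, div_le_one (by linarith)]; linarith
      exact (mul_le_mul_of_nonneg_left h3 hβ').trans h4
    have hu : β' * γ ^ 2 ≤ 3 / 4 := by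
      have e : β' * γ ^ 2 = (β' * γ) * γ := by ring
      rw [e]
      calc (β' * γ) * γ ≤ 1 * (1 / 2) := mul_le_mul hprod h2 hγ0'.le zero_le_one
        _ ≤ 3 / 4 := by norm_num
  · rw [neg_neg]; nlinarith [sq_nonneg γ]
  · exact hu

/-! ## §1. The (2.4) profile at `p₀ = 1` is 2-comparable along 2-comparable couplings in `]0, ½]` — no monotonicity, no sign -/

/-- `0 < x ≤ 2y`, `x, y ≤ ½` ⟹ `x·log x⁻¹ ≤ 2·(y·log y⁻¹)` (case `x ≤ y`: 13d's `mul_log_inv_le_two_mul`; case `y < x ≤ 2y`: `log x⁻¹ ≤ log y⁻¹`, `0 ≤ log x⁻¹`) — the (2.4) profile's 2-comparability.  (node O P3 g48 §1.) [cite: Balaban1988Convergent, (2.4) p.255, (2.7)–(2.8) pp.255–256 (bookkeeping)] -/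
theorem mul_log_inv_le_two_mul_of_le_two_mul {x y : ℝ} (hx : 0 < x) (hy : 0 < y) (hx2 : x ≤ 1 / 2) (hy2 : y ≤ 1 / 2) (hc : x ≤ 2 * y) :
    x * Real.log x⁻¹ ≤ 2 * (y * Real.log y⁻¹) := by
  rcases le_or_gt x y with hxy | hyx
  · exact mul_log_inv_le_two_mul hx hxy hy2
  · have hlogx : 0 ≤ Real.log x⁻¹ := Real.log_nonneg ((one_le_inv₀ hx).mpr (by linarith))
    have hlog : Real.log x⁻¹ ≤ Real.log y⁻¹ := Real.log_le_log (inv_pos.mpr hx) (inv_anti₀ hy hyx.le)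
    calc x * Real.log x⁻¹ ≤ (2 * y) * Real.log x⁻¹ := mul_le_mul_of_nonneg_right hc hlogx
      _ ≤ (2 * y) * Real.log y⁻¹ := mul_le_mul_of_nonneg_left hlog (by linarith)
      _ = 2 * (y * Real.log y⁻¹) := by ring

/-- The `ε`-form at `p₀ = 1`, `0 ≤ A₀`: `0 < g_i ≤ 2·g_j`, both `≤ ½` ⟹ `ε_i ≤ 2·ε_j` (`ε_k = g_k·A₀·log g_k⁻²`, [III] (2.4)).  (node O P3 g48 §1.) [cite: Balaban1988Convergent, (2.4) p.255, (2.7)–(2.8) pp.255–256] -/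
theorem epsOfRecord_le_two_mul_of_le_two_mul (ν : Stage7Numerics) (hp : ν.p₀ = 1) (hA : 0 ≤ ν.A₀) {g : ℕ → ℝ} {i j : ℕ}
    (hi : 0 < g i) (hj : 0 < g j) (hi2 : g i ≤ 1 / 2) (hj2 : g j ≤ 1 / 2) (hc : g i ≤ 2 * g j) :
    epsOfRecord ν g i ≤ 2 * epsOfRecord ν g j := by
  unfold epsOfRecord p0Profile
  rw [hp, pow_one, pow_one]
  have hsq : ∀ x : ℝ, 0 < x → Real.log (x ^ 2)⁻¹ = 2 * Real.log x⁻¹ := by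
    intro x _
    rw [← inv_pow, Real.log_pow]
    norm_num
  rw [hsq _ hi, hsq _ hj]
  have key := mul_log_inv_le_two_mul_of_le_two_mul hi hj hi2 hj2 hc
  have hA2 : 0 ≤ 2 * ν.A₀ := by positivity
  calc g i * (ν.A₀ * (2 * Real.log (g i)⁻¹)) = 2 * ν.A₀ * (g i * Real.log (g i)⁻¹) := by ring
    _ ≤ 2 * ν.A₀ * (2 * (g j * Real.log (g j)⁻¹)) := mul_le_mul_of_nonneg_left key hA2
    _ = 2 * (g j * (ν.A₀ * (2 * Real.log (g j)⁻¹))) := by ring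

/-! ## §2. One RG step `g′⁻² = g⁻² − β` ((0.20)): 2-comparability of consecutive couplings from ONE-SIDED β-bounds of either sign; along `genSeq` from the sign-free box -/

/-- `g⁻² ≤ g′⁻² + t`, `t·g² ≤ ¾` ⟹ `g′ ≤ 2g` (`t` of any sign).  (node O P3 g48 §2.) [cite: Balaban1987RG1, (0.20) p.256; Balaban1988Convergent, (2.6) p.255] -/
theorem le_two_mul_of_inv_sq_step_upper {g g' t : ℝ} (hg : 0 < g) (hg' : 0 < g') (hstep : (g ^ 2)⁻¹ ≤ (g' ^ 2)⁻¹ + t) (ht : t * g ^ 2 ≤ 3 / 4) :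
    g' ≤ 2 * g := by
  have ha2 : 0 < g ^ 2 := pow_pos hg 2
  have hc2 : 0 < g' ^ 2 := pow_pos hg' 2
  have h1 : g' ^ 2 ≤ g ^ 2 + t * (g ^ 2 * g' ^ 2) := by
    have h := mul_le_mul_of_nonneg_right hstep (le_of_lt (mul_pos ha2 hc2))
    have e1 : (g ^ 2)⁻¹ * (g ^ 2 * g' ^ 2) = g' ^ 2 := by rw [← mul_assoc, inv_mul_cancel₀ ha2.ne', one_mul]
    have e2 : ((g' ^ 2)⁻¹ + t) * (g ^ 2 * g' ^ 2) = g ^ 2 + t * (g ^ 2 * g' ^ 2) := by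
      rw [add_mul, mul_comm (g ^ 2) (g' ^ 2), ← mul_assoc, inv_mul_cancel₀ hc2.ne', one_mul, mul_comm (g' ^ 2) (g ^ 2)]
    rwa [e1, e2] at h
  have h2 : g' ^ 2 ≤ (2 * g) ^ 2 := by
    have hq : 0 ≤ g' ^ 2 * (3 / 4 - t * g ^ 2) := mul_nonneg hc2.le (by linarith)
    nlinarith [h1, hq]
  exact (pow_le_pow_iff_left₀ hg'.le (by positivity) two_ne_zero).mp h2

/-- `g′⁻² ≤ g⁻² + t`, `t·g² ≤ 3` ⟹ `g ≤ 2g′` (`t` of any sign).  (node O P3 g48 §2.) [cite: Balaban1987RG1, (0.20) p.256; Balaban1988Convergent, (2.6) p.255] -/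
theorem le_two_mul_of_inv_sq_step_lower {g g' t : ℝ} (hg : 0 < g) (hg' : 0 < g') (hstep : (g' ^ 2)⁻¹ ≤ (g ^ 2)⁻¹ + t) (ht : t * g ^ 2 ≤ 3) :
    g ≤ 2 * g' := by
  have ha2 : 0 < g ^ 2 := pow_pos hg 2
  have hc2 : 0 < g' ^ 2 := pow_pos hg' 2
  have h1 : g ^ 2 ≤ g' ^ 2 + t * (g ^ 2 * g' ^ 2) := by
    have h := mul_le_mul_of_nonneg_right hstep (le_of_lt (mul_pos ha2 hc2))
    have e1 : (g' ^ 2)⁻¹ * (g ^ 2 * g' ^ 2) = g ^ 2 := by rw [mul_comm (g ^ 2) (g' ^ 2), ← mul_assoc, inv_mul_cancel₀ hc2.ne', one_mul]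
    have e2 : ((g ^ 2)⁻¹ + t) * (g ^ 2 * g' ^ 2) = g' ^ 2 + t * (g ^ 2 * g' ^ 2) := by
      rw [add_mul, ← mul_assoc, inv_mul_cancel₀ ha2.ne', one_mul]
    rwa [e1, e2] at h
  have h2 : g ^ 2 ≤ (2 * g') ^ 2 := by
    have hq : t * g ^ 2 * g' ^ 2 ≤ 3 * g' ^ 2 := mul_le_mul_of_nonneg_right ht hc2.le
    nlinarith [h1, hq]
  exact (pow_le_pow_iff_left₀ hg.le (by positivity) two_ne_zero).mp h2

/-- **★ BOTH COMPARABILITY CLAUSES ALONG `genSeq β g₀` FROM THE WINDOW AND A SIGN-FREE β-BOX** ([III] (2.6)–(2.8) «from the renormalization group equations (0.20) and from the properties of the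
β-functions»): `0 < g_j ≤ γ ≤ ½` for `j ≤ n`, `bₗ ≤ β_j ≤ β′` on the boxes (`bₗ`, `β′` of ANY sign), letters `−bₗ·γ² ≤ 3`, `β′·γ² ≤ ¾`, `0 ≤ A₀`, `p₀ = 1` ⟹ `ε_m ≤ 2ε_{m+1}` AND `ε_{m+1} ≤ 2ε_m`
for every `m < n`.  (node O P3 g48 §2.) [cite: Balaban1988Convergent, (2.4) p.255, (2.6)–(2.8) pp.255–256; Balaban1987RG1, (0.20) p.256, §1 p.264] -/
theorem hcompBoth_genSeq_of_betaBoxSignFree (ν : Stage7Numerics) (hp : ν.p₀ = 1) (hA : 0 ≤ ν.A₀) {β : HBeta} {g0 γ bl β' : ℝ} {n : ℕ}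
    (hI : Step.InInterval γ n (genSeq β g0)) (hγ : γ ≤ 1 / 2) (hlo : BetaLowerH bl γ β) (hup : BetaUpperH β' γ β)
    (hl : -bl * γ ^ 2 ≤ 3) (hu : β' * γ ^ 2 ≤ 3 / 4) :
    (∀ m, m < n → epsOfRecord ν (genSeq β g0) m ≤ 2 * epsOfRecord ν (genSeq β g0) (m + 1)) ∧
    (∀ m, m < n → epsOfRecord ν (genSeq β g0) (m + 1) ≤ 2 * epsOfRecord ν (genSeq β g0) m) := by
  have key : ∀ m, m < n → genSeq β g0 m ≤ 2 * genSeq β g0 (m + 1) ∧ genSeq β g0 (m + 1) ≤ 2 * genSeq β g0 m := by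
    intro m hm
    have hgm := hI m hm.le
    have hgm' := hI (m + 1) hm
    have hbox : prefixOf (genSeq β g0) m ∈ Box γ m :=
      mem_box.mpr fun i => hI i (by have := i.isLt; omega)
    have hβlo : bl ≤ β m (prefixOf (genSeq β g0) m) := hlo m _ hbox
    have hβup : β m (prefixOf (genSeq β g0) m) ≤ β' := hup m _ hbox
    have hid := inv_sq_genSeq_succ β g0 hgm'.1
    have hg2 : genSeq β g0 m ^ 2 ≤ γ ^ 2 := pow_le_pow_left₀ hgm.1.le hgm.2 2
    have hg2nn : 0 ≤ genSeq β g0 m ^ 2 := sq_nonneg _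
    refine ⟨le_two_mul_of_inv_sq_step_lower (t := -bl) hgm.1 hgm'.1 (by rw [hid]; linarith) ?_,
      le_two_mul_of_inv_sq_step_upper (t := β') hgm.1 hgm'.1 (by rw [hid]; linarith) ?_⟩
    · rcases le_or_gt 0 bl with hbl | hbl
      · nlinarith [hg2nn, hbl]
      · exact (mul_le_mul_of_nonneg_left hg2 (by linarith)).trans hl
    · rcases le_or_gt 0 β' with hb' | hb'
      · exact (mul_le_mul_of_nonneg_left hg2 hb').trans hu
      · nlinarith [hg2nn, hb']
  refine ⟨fun m hm => ?_, fun m hm => ?_⟩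
  · have hgm := hI m hm.le
    have hgm' := hI (m + 1) hm
    exact epsOfRecord_le_two_mul_of_le_two_mul ν hp hA hgm.1 hgm'.1 (hgm.2.trans hγ) (hgm'.2.trans hγ) (key m hm).1
  · have hgm := hI m hm.le
    have hgm' := hI (m + 1) hm
    exact epsOfRecord_le_two_mul_of_le_two_mul ν hp hA hgm'.1 hgm.1 (hgm'.2.trans hγ) (hgm.2.trans hγ) (key m hm).2

/-! ## §3. ★ THE θ-GENERIC CONSUMER: both history clauses of row `bg` along every windowed run of a Stage-13 parameter from the sign-free box at `θ.γ ≤ ½` -/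

section Generic

variable {F : T4Family} {N : ℕ} [NeZero N]

/-- **★ (hcomp) ∧ (hcompRev) AT A GENERIC `θ : Stage13Params F N` FROM THE SIGN-FREE β-BOX ON `]0, θ.γ]`** (`θ.γ ≤ ½`, `p₀ = 1`, `0 ≤ A₀`, `0 ≤ cR`; `gOfRecord₁₃ θ p = genSeq β₁₃(θ) g₀(p)`):
`BetaLowerH bₗ θ.γ β₁₃(θ)`, `BetaUpperH β′ θ.γ β₁₃(θ)`, `−bₗ·θ.γ² ≤ 3`, `β′·θ.γ² ≤ ¾` ⟹ for every run `p`, `n ≤ K`, history in the window up to `n`, and `m < n`: `cR·ε_m ≤ 2·(cR·ε_{m+1})` and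
`cR·ε_{m+1} ≤ 2·(cR·ε_m)`.  The SIGN of β is not among the hypotheses (compare 13e's `hmono_of_betaLowerH (hb : 0 ≤ b)` and 14d's `hcompRev_of_betaBox (hb : 0 ≤ b)`).  CONDITIONAL on the
displayed box; nothing of Bałaban asserted.  (node O P3 g48 §3.) [cite: Balaban1988Convergent, (2.4) p.255, (2.6)–(2.8) pp.255–256; Balaban1987RG1, (0.20) p.256, §1 p.264] -/
theorem Stage13Params.hcompBoth_of_betaBoxSignFree (θ : Stage13Params F N) (hA : 0 ≤ θ.ν.A₀) (hp : θ.ν.p₀ = 1) (hγ : θ.γ ≤ 1 / 2) (hcR : 0 ≤ θ.s2.cR)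
    {bl β' : ℝ} (hlow : BetaLowerH bl θ.γ (betaOfRecord₁₃ F N θ)) (hup : BetaUpperH β' θ.γ (betaOfRecord₁₃ F N θ))
    (hl : -bl * θ.γ ^ 2 ≤ 3) (hu : β' * θ.γ ^ 2 ≤ 3 / 4) :
    (∀ (p : B12.RunParams) (n : ℕ), n ≤ p.K → Step.InInterval θ.γ n (gOfRecord₁₃ F N θ p) → ∀ m, m < n →
      θ.s2.cR * epsOfRecord θ.ν (gOfRecord₁₃ F N θ p) m ≤ 2 * (θ.s2.cR * epsOfRecord θ.ν (gOfRecord₁₃ F N θ p) (m + 1))) ∧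
    (∀ (p : B12.RunParams) (n : ℕ), n ≤ p.K → Step.InInterval θ.γ n (gOfRecord₁₃ F N θ p) → ∀ m, m < n →
      θ.s2.cR * epsOfRecord θ.ν (gOfRecord₁₃ F N θ p) (m + 1) ≤ 2 * (θ.s2.cR * epsOfRecord θ.ν (gOfRecord₁₃ F N θ p) m)) :=
  ⟨fun _ _ _ hw => hcomp_mul_of_hcomp θ.ν hcR (hcompBoth_genSeq_of_betaBoxSignFree θ.ν hp hA hw hγ hlow hup hl hu).1,
    fun _ _ _ hw => hcompRev_mul_of_hcompRev θ.ν hcR (hcompBoth_genSeq_of_betaBoxSignFree θ.ν hp hA hw hγ hlow hup hl hu).2⟩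

end Generic

/-! ## §4ʷ. At the windowed collared witness `θ₁₅ᶜᶜᴹ(j; γ)` (`.γ = γ` by `rfl`, `p₀ = 1`, `cR = 1`, `A₀ = A₀ᶜᶜ¹ ≥ 0`): both clauses from the sign-free box on `]0, γ]`, `γ ≤ ½` — of its own
β-functions, and (A2ʷ §5 transfer) of A1's witness's β-functions -/

section AtWitnessW

variable {F : T4Family} {N : ℕ} [NeZero N] {j : ℕ} {γ ε₀ ε₂₉ B₃ B₃' a₀ a₁ : ℝ}

/-- **★ʷ (hcomp) ∧ (hcompRev) AT `θ₁₅ᶜᶜᴹ(j; γ)` FROM THE SIGN-FREE β-BOX OF ITS OWN β-FUNCTIONS ON `]0, γ]`** (`γ ≤ ½`; `bₗ`, `β′` of any sign with `−bₗ·γ² ≤ 3`, `β′·γ² ≤ ¾`; weak signs of the class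
constants) — §3 at `θ := θ₁₅ᶜᶜᴹ(j; γ)`.  Replaces A2ʷ §6's signed pair.  CONDITIONAL on the displayed box.  (node O P3 g48 §4ʷ.) [cite: Balaban1988Convergent, (2.4) p.255, (2.6)–(2.8) pp.255–256; Balaban1987RG1, (0.20) p.256, §1 p.264] -/
theorem hcompBoth_theta13OfThm1CCMW_of_betaBoxSignFree (hγ : γ ≤ 1 / 2) (hB : 0 ≤ B₃) (hB' : 0 ≤ B₃') (ha₀ : 0 ≤ a₀) (ha₁ : 0 ≤ a₁) {bl β' : ℝ}
    (hlow : BetaLowerH bl γ (betaOfRecord₁₃ F N (theta13OfThm1CCMW F N j γ ε₀ ε₂₉ B₃ B₃' a₀ a₁)))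
    (hup : BetaUpperH β' γ (betaOfRecord₁₃ F N (theta13OfThm1CCMW F N j γ ε₀ ε₂₉ B₃ B₃' a₀ a₁))) (hl : -bl * γ ^ 2 ≤ 3) (hu : β' * γ ^ 2 ≤ 3 / 4) :
    (∀ (p : B12.RunParams) (n : ℕ), n ≤ p.K → Step.InInterval (theta13OfThm1CCMW F N j γ ε₀ ε₂₉ B₃ B₃' a₀ a₁).γ n (gOfRecord₁₃ F N (theta13OfThm1CCMW F N j γ ε₀ ε₂₉ B₃ B₃' a₀ a₁) p) → ∀ m, m < n →
      (theta13OfThm1CCMW F N j γ ε₀ ε₂₉ B₃ B₃' a₀ a₁).s2.cR * epsOfRecord (theta13OfThm1CCMW F N j γ ε₀ ε₂₉ B₃ B₃' a₀ a₁).ν (gOfRecord₁₃ F N (theta13OfThm1CCMW F N j γ ε₀ ε₂₉ B₃ B₃' a₀ a₁) p) m ≤ 2 * ((theta13OfThm1CCMW F N j γ ε₀ ε₂₉ B₃ B₃' a₀ a₁).s2.cR * epsOfRecord (theta13OfThm1CCMW F N j γ ε₀ ε₂₉ B₃ B₃' a₀ a₁).ν (gOfRecord₁₃ F N (theta13OfThm1CCMW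 F N j γ ε₀ ε₂₉ B₃ B₃' a₀ a₁) p) (m + 1))) ∧
    (∀ (p : B12.RunParams) (n : ℕ), n ≤ p.K → Step.InInterval (theta13OfThm1CCMW F N j γ ε₀ ε₂₉ B₃ B₃' a₀ a₁).γ n (gOfRecord₁₃ F N (theta13OfThm1CCMW F N j γ ε₀ ε₂₉ B₃ B₃' a₀ a₁) p) → ∀ m, m < n →
      (theta13OfThm1CCMW F N j γ ε₀ ε₂₉ B₃ B₃' a₀ a₁).s2.cR * epsOfRecord (theta13OfThm1CCMW F N j γ ε₀ ε₂₉ B₃ B₃' a₀ a₁).ν (gOfRecord₁₃ F N (theta13OfThm1CCMW F N j γ ε₀ ε₂₉ B₃ B₃' a₀ a₁) p) (m + 1) ≤ 2 * ((theta13OfThm1CCMW F N j γ ε₀ ε₂₉ B₃ B₃' a₀ a₁).s2.cR * epsOfRecord (theta13OfThm1CCMW F N j γ ε₀ ε₂₉ B₃ B₃' a₀ a₁).ν (gOfRecord₁₃ F N (theta13OfThm1CCMW F N j γ ε₀ ε₂₉ B₃ B₃' a₀ a₁) p) m)) := by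
  have hγ' := theta13OfThm1CCMW_γ F N j γ ε₀ ε₂₉ B₃ B₃' a₀ a₁
  refine (theta13OfThm1CCMW F N j γ ε₀ ε₂₉ B₃ B₃' a₀ a₁).hcompBoth_of_betaBoxSignFree (bl := bl) (β' := β')
    (by rw [theta13OfThm1CCMW_A₀]; exact A0OfThm1CC1_nonneg hB hB' ha₀ ha₁) (theta13OfThm1CCMW_p₀ F N j γ ε₀ ε₂₉ B₃ B₃' a₀ a₁) (by rw [hγ']; exact hγ)
    (by rw [theta13OfThm1CCMW_cR]; norm_num) (by rw [hγ']; exact hlow) (by rw [hγ']; exact hup) ?_ ?_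
  · rw [hγ']; exact hl
  · rw [hγ']; exact hu

/-- **★★ʷ THE SAME FROM THE SIGN-FREE BOX OF A1's WITNESS `β₁₃(θ₁₅ᶜᶜᴹ(j))` ON `]0, γ]`** (A2ʷ §5 transfer `betaLowerH∕betaUpperH_theta13OfThm1CCMW_of_half` BY NAME).  These hypotheses are the
WINDOWED TWO-SIDED BOX WITH LETTERS — dag-n21-c's 3ʷ text with `0 ≤ b` replaced by the letter `−b·γ² ≤ 3`.  CONDITIONAL.  (node O P3 g48 §4ʷ.) [cite: Balaban1987RG1, (1.20)–(1.22) p.264, (0.20) p.256, §1 p.264; Balaban1988Convergent, (2.4)–(2.8) pp.255–256] -/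
theorem hcompBoth_theta13OfThm1CCMW_of_betaBoxSignFree_half (hγ : γ ≤ 1 / 2) (hB : 0 ≤ B₃) (hB' : 0 ≤ B₃') (ha₀ : 0 ≤ a₀) (ha₁ : 0 ≤ a₁) {bl β' : ℝ}
    (hlow : BetaLowerH bl γ (betaOfRecord₁₃ F N (theta13OfThm1CCM F N j ε₀ ε₂₉ B₃ B₃' a₀ a₁)))
    (hup : BetaUpperH β' γ (betaOfRecord₁₃ F N (theta13OfThm1CCM F N j ε₀ ε₂₉ B₃ B₃' a₀ a₁))) (hl : -bl * γ ^ 2 ≤ 3) (hu : β' * γ ^ 2 ≤ 3 / 4) :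
    (∀ (p : B12.RunParams) (n : ℕ), n ≤ p.K → Step.InInterval (theta13OfThm1CCMW F N j γ ε₀ ε₂₉ B₃ B₃' a₀ a₁).γ n (gOfRecord₁₃ F N (theta13OfThm1CCMW F N j γ ε₀ ε₂₉ B₃ B₃' a₀ a₁) p) → ∀ m, m < n →
      (theta13OfThm1CCMW F N j γ ε₀ ε₂₉ B₃ B₃' a₀ a₁).s2.cR * epsOfRecord (theta13OfThm1CCMW F N j γ ε₀ ε₂₉ B₃ B₃' a₀ a₁).ν (gOfRecord₁₃ F N (theta13OfThm1CCMW F N j γ ε₀ ε₂₉ B₃ B₃' a₀ a₁) p) m ≤ 2 * ((theta13OfThm1CCMW F N j γ ε₀ ε₂₉ B₃ B₃' a₀ a₁).s2.cR * epsOfRecord (theta13OfThm1CCMW F N j γ ε₀ ε₂₉ B₃ B₃' a₀ a₁).ν (gOfRecord₁₃ F N (theta13OfThm1CCMW F N j γ ε₀ ε₂₉ B₃ B₃' a₀ a₁) p) (m + 1))) ∧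
    (∀ (p : B12.RunParams) (n : ℕ), n ≤ p.K → Step.InInterval (theta13OfThm1CCMW F N j γ ε₀ ε₂₉ B₃ B₃' a₀ a₁).γ n (gOfRecord₁₃ F N (theta13OfThm1CCMW F N j γ ε₀ ε₂₉ B₃ B₃' a₀ a₁) p) → ∀ m, m < n →
      (theta13OfThm1CCMW F N j γ ε₀ ε₂₉ B₃ B₃' a₀ a₁).s2.cR * epsOfRecord (theta13OfThm1CCMW F N j γ ε₀ ε₂₉ B₃ B₃' a₀ a₁).ν (gOfRecord₁₃ F N (theta13OfThm1CCMW F N j γ ε₀ ε₂₉ B₃ B₃' a₀ a₁) p) (m + 1) ≤ 2 * ((theta13OfThm1CCMW F N j γ ε₀ ε₂₉ B₃ B₃' a₀ a₁).s2.cR * epsOfRecord (theta13OfThm1CCMW F N j γ ε₀ ε₂₉ B₃ B₃' a₀ a₁).ν (gOfRecord₁₃ F N (theta13OfThm1CCMW F N j γ ε₀ ε₂₉ B₃ B₃' a₀ a₁) p) m)) :=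
  hcompBoth_theta13OfThm1CCMW_of_betaBoxSignFree hγ hB hB' ha₀ ha₁ (betaLowerH_theta13OfThm1CCMW_of_half hγ hlow) (betaUpperH_theta13OfThm1CCMW_of_half hγ hup) hl hu

end AtWitnessW

end Literature.MathematicalPhysics.QuantumFieldTheory.Balaban1983to89.Node00

end
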